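import Summits.Parity.GeneralizedHardyLittlewood.Theorems.GreenTaoLevelTwoGITwoCyclicInverseGraphSliceOfU3
import Summits.Parity.GeneralizedHardyLittlewood.Theorems.GreenTaoLevelTwoGITwoCyclicInverseBogolyubovBohr
import Summits.Parity.GeneralizedHardyLittlewood.Theorems.GreenTaoLevelTwoGITwoCyclicInverseLocalHom

/-!
# Route `GreenTaoLevelTwo`, crux `GITwo` (stmt-Parity-21275), line `birth`, stub `stub_cyclicInverse`:
# a locally additive frequency map on a Bohr set (core of GT08a arXiv Prop. 43, qualitative)

Twentieth helper file toward the XL stub `stub_cyclicInverse` (B. Green, T. Tao, arXiv:math/0503014,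
Thm. 68 = PEMS 51 (2008) Thm. 12.8).  Combining the interface `exists_graph_slice_of_gowersPower_three`
(`…GraphSliceOfU3`), Bogolyubov in Bohr form (`…BogolyubovBohr`) and the locally additive section
(`…LocalHom`): from `‖f‖_{U³(ℤ/Mℤ)}^8 ≥ ε` (`M` prime, `|f| ≤ 1`) we obtain the derivative-frequency
set `H''`, its spectrum `Spec` (`#Spec · β³/4 ≤ β`, `β = #H''/M`) and a map `μ : ℤ/Mℤ → ℤ/Mℤ` which is
ADDITIVE on the Bohr set `B = B(Spec, ¼)` (whenever `h₁, h₂, h₁+h₂ ∈ B`) and whose graph over `B` lies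
in `2Γ'' − 2Γ''` — the "locally linear `M : B(S,¼) → Ĝ`" of arXiv Prop. 43 (there `ξ_{x₀+h} =
2Mh + ξ₀`; the factor `2`, the base point `x₀` and the density count of Prop. 43 are NOT done here).

* `image_fst_image_graph` — `pr₁{(t, ξ_t) : t ∈ H} = H`;
* `mem_two_nsmul_sub_of_repr` — `(a − c) + (b − d) ∈ 2H − 2H` for `a,b,c,d ∈ H`;
* `exists_locally_additive_on_bohr` — the statement above.

References: [GreenTao2008U3Inverse] arXiv:math/0503014, Prop. 43 (Step 1 of §9), Lemma 30, Lemma 44.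
-/

noncomputable section

namespace Summit.Parity.GeneralizedHardyLittlewood.GreenTaoLevelTwoGITwoCyclicInverse

open Finset
open scoped Pointwise

open Literature.NumberTheory.Sieve

variable {M : ℕ} [NeZero M]

omit [NeZero M] in
/-- `pr₁` of a graph is its domain. [folklore] -/
theorem image_fst_image_graph (H : Finset (ZMod M)) (ξ : ZMod M → ZMod M) :
    (H.image fun t => (t, ξ t)).image Prod.fst = H := by
  rw [image_image]
  have : (Prod.fst ∘ fun t : ZMod M => (t, ξ t)) = id := by
    funext t; rfl
  rw [this, image_id]

omit [NeZero M] in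
/-- `(a − c) + (b − d) ∈ 2H − 2H` for `a, b, c, d ∈ H`. [folklore] -/
theorem mem_two_nsmul_sub_of_repr {H : Finset (ZMod M)} {a b c d : ZMod M} (ha : a ∈ H) (hb : b ∈ H)
    (hc : c ∈ H) (hd : d ∈ H) : a - c + (b - d) ∈ 2 • H - 2 • H := by
  rw [show a - c + (b - d) = (a + b) - (c + d) by abel, two_nsmul]
  exact sub_mem_sub (add_mem_add ha hb) (add_mem_add hc hd)

/-- **Core of GT08a arXiv Prop. 43 (qualitative): a locally additive frequency map on a Bohr set.**
For `M` prime, `|f| ≤ 1` and `‖f‖_{U³}^8 ≥ ε > 0` there are `H'' ⊆ ℤ/Mℤ`, `ξ`, `μ : ℤ/Mℤ → ℤ/Mℤ`,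
`d ≤ (2²²⁵ε⁻¹⁶⁸)¹⁷` and a spectrum `Spec` with: `|(Δ_t f)^(ξ_t)|² ≥ ε/2` on `H''`;
`#H'' ≥ ε¹⁷M/(2²³128^d)`; `#Spec · (β³/4) ≤ β` (`β = #H''/M`); for every `h` in the Bohr set
`B = {h : ‖toAddCircle(hξ')‖ ≤ ¼ ∀ ξ' ∈ Spec}` the point `(h, μ h)` lies in `2Γ'' − 2Γ''`
(`Γ'' = {(t, ξ_t) : t ∈ H''}`); and `μ(h₁ + h₂) = μ h₁ + μ h₂` whenever `h₁, h₂, h₁ + h₂ ∈ B`.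
[cite: GreenTao2008U3Inverse, Prop. 43] -/
theorem exists_locally_additive_on_bohr (hM : M.Prime) {f : ZMod M → ℝ} (hf : ∀ x, |f x| ≤ 1)
    {ε : ℝ} (hε0 : 0 < ε) (hε : ε ≤ gowersPower 3 f) :
    ∃ (H'' Spec : Finset (ZMod M)) (ξ μ : ZMod M → ZMod M) (d : ℕ),
      (d : ℝ) ≤ (2 ^ 225 / ε ^ 168) ^ 17 ∧
      (∀ t ∈ H'', ε / 2 ≤ ‖dftCoeff (fun y => f y * f (y + t)) (ξ t)‖ ^ 2) ∧
      ε ^ 17 / 2 ^ 23 * M / (128 : ℝ) ^ d ≤ #H'' ∧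
      (#Spec : ℝ) * (((#H'' : ℝ) / M) ^ 3 / 4) ≤ (#H'' : ℝ) / M ∧
      (∀ h : ZMod M, (∀ ξ' ∈ Spec, ‖ZMod.toAddCircle (h * ξ')‖ ≤ 1 / 4) →
        (h, μ h) ∈ 2 • (H''.image fun t => (t, ξ t)) - 2 • (H''.image fun t => (t, ξ t))) ∧
      (∀ h₁ h₂ : ZMod M, (∀ ξ' ∈ Spec, ‖ZMod.toAddCircle (h₁ * ξ')‖ ≤ 1 / 4) →
        (∀ ξ' ∈ Spec, ‖ZMod.toAddCircle (h₂ * ξ')‖ ≤ 1 / 4) →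
        (∀ ξ' ∈ Spec, ‖ZMod.toAddCircle ((h₁ + h₂) * ξ')‖ ≤ 1 / 4) →
        μ (h₁ + h₂) = μ h₁ + μ h₂) := by
  classical
  have hMpos : (0 : ℝ) < M := by exact_mod_cast Nat.pos_of_ne_zero (NeZero.ne M)
  obtain ⟨H'', ξ, d, hd, hfreq, hcard, hgraph4⟩ :=
    exists_graph_slice_of_gowersPower_three hM hf hε0 hε
  set Γ'' : Finset (ZMod M × ZMod M) := H''.image fun t => (t, ξ t) with hΓ''
  have hH''pos : (0 : ℝ) < #H'' := by
    refine lt_of_lt_of_le ?_ hcard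
    have h1 : (0 : ℝ) < ε ^ 17 / 2 ^ 23 * M := by positivity
    exact div_pos h1 (pow_pos (by norm_num) _)
  have hH''ne : H''.Nonempty := by
    rw [← card_pos]; exact_mod_cast hH''pos
  have hΓ''ne : Γ''.Nonempty := hH''ne.image _
  -- the locally additive section
  obtain ⟨μ, -, hμmem, hμadd⟩ := exists_locally_additive_section Γ'' hΓ''ne hgraph4
  have hpr : Γ''.image Prod.fst = H'' := image_fst_image_graph H'' ξ
  rw [hpr] at hμmem hμadd
  -- the spectrum of `H''`
  set Spec : Finset (ZMod M) := Finset.univ.filter fun ξ' : ZMod M => ξ' ≠ 0 ∧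
      ((#H'' : ℝ) / M) ^ 3 / 4 ≤ ‖dftCoeff (fun y => if y ∈ H'' then (1 : ℝ) else 0) ξ'‖ ^ 2
    with hSpec
  have hSpec_card : (#Spec : ℝ) * (((#H'' : ℝ) / M) ^ 3 / 4) ≤ (#H'' : ℝ) / M :=
    card_largeSpec_mul_le H'' Spec fun ξ' hξ' => by
      rw [hSpec, mem_filter] at hξ'; exact hξ'.2.2
  -- the Bohr set of the spectrum sits inside `2H'' − 2H''`
  have hbohr : ∀ h : ZMod M, (∀ ξ' ∈ Spec, ‖ZMod.toAddCircle (h * ξ')‖ ≤ 1 / 4) →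
      h ∈ 2 • H'' - 2 • H'' := by
    intro h hh
    obtain ⟨a, ha, c, hc, b, hb, d', hd', heq⟩ :=
      bohr_largeSpec_subset_two_sub_two hH''ne h fun ξ' hξ'0 hspec =>
        hh ξ' (by rw [hSpec, mem_filter]; exact ⟨mem_univ _, hξ'0, hspec⟩)
    rw [← heq]
    exact mem_two_nsmul_sub_of_repr ha hb hc hd'
  refine ⟨H'', Spec, ξ, μ, d, hd, hfreq, hcard, hSpec_card,
    fun h hh => hμmem h (hbohr h hh), fun h₁ h₂ hh₁ hh₂ hh₁₂ => ?_⟩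
  exact hμadd h₁ h₂ (hbohr h₁ hh₁) (hbohr h₂ hh₂) (hbohr _ hh₁₂)

end Summit.Parity.GeneralizedHardyLittlewood.GreenTaoLevelTwoGITwoCyclicInverse
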